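import Summits.HodgeConjecture.HodgeConjecture.Cruxes.BlochSeedDiscOne.SeedChecker
import Literature.AlgebraicGeometry.Resolution.SmoothStalksRegular
import Literature.AlgebraicGeometry.Motives.GoodReductionSpecialFibreProofs
import Literature.AlgebraicGeometry.HodgeTheory.RegularImmersionCodim
import Literature.AlgebraicGeometry.Motives.AbelianVarietyProjectiveChart
import Literature.AlgebraicGeometry.HodgeTheory.KodairaEmbeddingHyperplaneClassOfAmpleDivisorLines
import HarnessLib

/-!
# Seed checker v18 (hsemireg-c5c8-1 g17, 2026-08-30) — ADDITIVE satellite of `SeedChecker.lean` v4: C6 IS NOT A CHECK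
# «a regular zero locus that is smooth over `ℂ` and connected is integral of codimension `≥ 4` — THEOREM, not law»

Crux workfile for `stmt-HodgeConjecture-18881` (`BlochSeedDiscOne := HasHyperbolicBlochSeed 4 1`, route
`EightfoldBlochSeeds`); token of record
`line stmt-HodgeConjecture-18881 Cruxes/BlochSeedDiscOne/Lines/birth.lean 814a6a70c14e831a stub_rung_pad4_seedAt`.
MINT A5 «C5–C8 seed checker typing spec» (director-hodge): type the bc5 checks C5 (lci), C6 (integral, codimension clause), C7
(Bloch-semiregular), C8 (disc-one) and (σ) ∕ (A1@Z) as predicates on (design json, presentation) so that a seed checker exists before a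
candidate does, and FLAG every check that is vacuous or already implied. HONEST FRAMING: nothing in this file is proved toward
HC ∕ HC_CM ∕ HC_AV ∕ №4 ∕ 26512 ∕ 18881 ∕ H2; no bundle, section, zero scheme or design is constructed or certified; the stub
`stub_rung_pad4_seedAt` stays open. A typed file, not a rung.

SATELLITE DISCIPLINE (as v5–v17): imports ONLY v4 `SeedChecker.lean` (sha256 13437bb9848c3c36, the one crux workfile the farm snapshot
builds) plus BUILT Literature modules; does not import the satellites v5–v17 (unbuilt on the farm), restates nothing of theirs under
their names, and declares no `instance`, `notation`, `macro`, `axiom`, `sorry`.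

## What v18 adds (§18.1–§18.3)

* §18.1 **(L-int) DISCHARGED.** v17 (`SeedCheckerHighTwist.lean`) consumed «smooth over `ℂ` and connected ⟹ integral» as a NAMED LAW
  `(hint : SmoothConnectedIntegral)`. It is a THEOREM of the tree's ingredients: a scheme smooth over a field is reduced with integral
  local rings (`Resolution.isReduced_of_smooth`, `Resolution.isDomain_stalk_of_smooth`, Stacks 056S), locally Noetherian
  (`LocallyOfFiniteType.isLocallyNoetherian`), and a connected locally Noetherian scheme with integral local rings is irreducible
  (`Motives.irreducibleSpace_of_isDomain_stalk`, Görtz–Wedhorn I Ex. 3.16); `isIntegral_of_irreducibleSpace_of_isReduced`.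
  `isIntegral_of_smooth_connected` (any field, any universe) and `smoothConnectedIntegral_holds`, whose statement is v17's
  `def SmoothConnectedIntegral` VERBATIM (so in a joint build `smoothConnectedIntegral_holds : SmoothConnectedIntegral` by `Iff.rfl`-free
  definitional unfolding, and v17's `blochSeedDiscOne_of_highTwistChecks hconn hbert smoothConnectedIntegral_holds hloc …` drops one law).
* §18.2 **C6 ⟸ C5 ∧ smooth ∧ connected (THEOREM) — the C6-free checker.** Both conjuncts of C6 that v4's `Design.SeedCheck` carries —
  `IsIntegral Z` and `∀ z ∈ range i, 4 ≤ coheight z` — follow from C5 (`IsRegularImmersionOfCodim i 4`, via the tree's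
  `IsRegularImmersionOfCodim.le_coheight_of_mem_range`, Bruns–Herzog 1.2.12) together with smoothness of `Z` over `ℂ` and connectedness
  (§18.1): `cSix_of_regular_smooth_connected` (any locally Noetherian `ℂ`-scheme as ambient), `cSix_pad4Anchor`. Hence the C6-FREE SEED CHECKER
  `Design.SmoothSeedCheck D K i q` := C0 ∧ closed immersion ∧ C5 ∧ `Smooth (i ≫ S⁴ → Spec ℂ)` ∧ `ConnectedSpace Z` ∧ C7 ∧ (σ), with
  `Design.SmoothSeedCheck.seedCheck : SmoothSeedCheck → SeedCheck` (SUFFICIENT, not equivalent: an integral lci seed may be singular —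
  flagged), its unpacking into the stub's conclusion on the anchor (`seedData_of_smoothSeedCheck`) and into the crux BY NAME on every CM
  anchor (`blochSeedDiscOne_of_smoothSeedChecks`), and the zero-scheme doors of v4 §7.3 with `hint`, `hcoh` REPLACED by smooth + connected
  (`Design.seedCheck_of_smoothZeroScheme`, `…_of_twistedKernelPresentation_smooth`, `…_of_twistedCokernelPresentation_smooth`,
  `blochSeedDiscOne_of_smoothZeroSchemes`). At high twist smoothness and connectedness are what (L-Bert) and (L-conn) deliver (v17), so
  after v18 the object side of the lci door reads: a section whose zero scheme is regular of codimension `4`, smooth, connected (free at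
  `t ≫ 0` given the two laws) and BLOCH-SEMIREGULAR (C7 — the one check).
* §18.3 **O-Θ (the ample divisor the high-twist laws quantify over) — what the tree gives.** Every abelian variety carries an ample
  (symmetric) Cartier divisor (`AbelianVariety.exists_isAmple_symmetric_holds`, Görtz–Wedhorn II 27.185): `exists_isAmple_pad4Anchor`. Sharper,
  from an `AnchorKit`: the hyperplane divisor `H_e` of the kit's projective embedding is ample and its divisor-class LINE is the line of
  `e^*a = t·h_std`, i.e. of `h_std` (`exists_isAmple_isDivisorClassLineOf_map_ι`, Görtz–Wedhorn 13.47 (iv) + Voisin I 7.14):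
  `exists_isAmple_lineOf_hStd`, `exists_isAmple_lineOf_symH`. FLAG (honest): v17's dictionary clause
  `∀ t, (D.tw t).RealisedBy C K.F h_std (twistBy 𝓔 Θ t)` pins `c₁^C(𝒪(Θ)) = h_std` ON THE NOSE in the abstract theory `C`; §18.3 places an
  ample `Θ` on the LINE `ℂ·h_std` in a Hodge model — the residual O-Θ_std is the normalisation «`C`'s first Chern class of `𝒪(H_e)` is
  `t·h_std` with the kit's `t`», a statement about the intended instance of `C` (topological Chern character), not derivable from the
  fields of `ChernCharacterBetti`. Recorded, not discharged.

## Flags of record after v18 (cumulative C5–C8 table in the memo `SEED-CHECKER-C5C8-c5c8-1-g17.md` §3)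

C8 (disc-one): in the types (v1). (σ) design half = C0's `μ ≠ 0`; object half ⟸ law `TopChernFourLocalisation` for zero schemes (v4).
(A1@Z) ⟸ presentation of the (twisted) design (v3 ∕ v4). C6: **IMPLIED by C5 ∧ smooth ∧ connected (v18, theorem)**; at high twist by
(L-Bert) ∧ (L-conn) (v17, laws) — no design datum enters. C5: object-side only (regular immersion of codimension `4`); at high twist ⟸ (L-Bert).
C7: THE check; no class-level screen beyond v2's `TraceAlive` and the budget `3136` (v6.2; STRENGTHEN MEMO-05: the Euler budget is not a budget).
-/

noncomputable section

set_option linter.dupNamespace false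

open CategoryTheory AlgebraicGeometry
open Literature.AlgebraicGeometry Literature.AlgebraicGeometry.Motives Literature.AlgebraicGeometry.HodgeTheory
open Literature.AlgebraicTopology.SingularHomology

namespace Summit.HodgeConjecture.HodgeConjecture.Cruxes.BlochSeedDiscOne.SeedChecker

open Summit.HodgeConjecture.HodgeConjecture.Cruxes.BlochSeedDiscOne.Anchor
open Summit.Ventures.HSemireg Summit.Ventures.HSemireg.Pad4Tower

/-! ## §18.1 (L-int) discharged: smooth over a field and connected ⟹ integral -/

section SmoothConnected

universe u

/-- **A scheme smooth over a field and connected is integral** (Stacks 056S + 0357; Görtz–Wedhorn I Prop. 3.27, Ex. 3.16): smooth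
over `K` ⟹ reduced with integral local rings and locally Noetherian; connected + locally Noetherian + integral local rings ⟹ irreducible.
Assembled from the tree's `Resolution.isReduced_of_smooth`, `Resolution.isDomain_stalk_of_smooth`, `Motives.irreducibleSpace_of_isDomain_stalk`
and Mathlib's `isIntegral_of_irreducibleSpace_of_isReduced` (the template is `FundamentalGroup.isIntegral_of_connectedSpace`).
[cite: GortzWedhorn2020, Prop. 3.27 and Exercise 3.16 (p. 117)] [cite: StacksProject, Tag 056S and Tag 0357] -/
theorem isIntegral_of_smooth_connected {K : Type u} [Field K] {Z : Scheme.{u}} (f : Z ⟶ Spec (CommRingCat.of K))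
    [Smooth f] [ConnectedSpace Z] : AlgebraicGeometry.IsIntegral Z := by
  haveI : IsReduced Z := Resolution.isReduced_of_smooth f
  haveI : IsLocallyNoetherian Z := LocallyOfFiniteType.isLocallyNoetherian f
  haveI : IrreducibleSpace Z :=
    irreducibleSpace_of_isDomain_stalk Z fun x ↦ Resolution.isDomain_stalk_of_smooth f x
  exact isIntegral_of_irreducibleSpace_of_isReduced Z

/-- **(L-int) AS STATED IN v17, NOW A THEOREM**: the statement below is `SeedCheckerHighTwist.SmoothConnectedIntegral` VERBATIM (a connected
scheme `Z`, closed in a `ℂ`-scheme `X` and smooth over `ℂ`, is integral; the closed-immersion hypothesis is not used). In a joint build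
`(smoothConnectedIntegral_holds : SmoothConnectedIntegral)` typechecks by unfolding, and v17's high-twist doors lose one law.
[cite: GortzWedhorn2020, Prop. 3.27 and Exercise 3.16] -/
theorem smoothConnectedIntegral_holds :
    ∀ (X : Motives.SchemeOver ℂ) ⦃Z : Scheme.{0}⦄ (i : Z ⟶ X.left), IsClosedImmersion i →
      AlgebraicGeometry.Smooth (i ≫ X.hom) → ConnectedSpace Z → AlgebraicGeometry.IsIntegral Z := by
  intro X Z i _ hsm hconn
  exact isIntegral_of_smooth_connected (i ≫ X.hom)

end SmoothConnected

/-! ## §18.2 C6 ⟸ C5 ∧ smooth ∧ connected; the C6-free seed checker and its doors -/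

section CSixFree

/-- the pad-4 anchor `S⁴` is locally Noetherian (finite type over `ℂ`). Stated as a `theorem` (no instances in crux workfiles):
use `haveI := isLocallyNoetherian_pad4Anchor E₀`. [folklore] -/
theorem isLocallyNoetherian_pad4Anchor (E₀ : AbelianVariety ℂ) : IsLocallyNoetherian (pad4Anchor E₀).X.left :=
  LocallyOfFiniteType.isLocallyNoetherian (pad4Anchor E₀).X.hom

/-- **C6 FROM C5 + SMOOTH + CONNECTED, on any locally Noetherian `ℂ`-scheme as ambient**: for `i : Z ⟶ X` a regular immersion of
codimension `p` (C5) with `Z` smooth over `ℂ` and connected, `Z` is integral AND every point of its image has codimension `≥ p` in `X`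
(`coheight = dim 𝒪_{X,x}`; the tree's `IsRegularImmersionOfCodim.le_coheight_of_mem_range`, Bruns–Herzog Prop. 1.2.12, needs only `X`
locally Noetherian). These are exactly the two C6 conjuncts of v4's `Design.SeedCheck` ∕ the stub's `HasBlochSeedAt`.
[cite: BrunsHerzog1998, §1.2 Prop. 1.2.12] [cite: GortzWedhorn2020, Exercise 3.16] -/
theorem cSix_of_regular_smooth_connected (X : Motives.SchemeOver ℂ) [IsLocallyNoetherian X.left] {Z : Scheme.{0}}
    {i : Z ⟶ X.left} {p : ℕ} (hreg : IsRegularImmersionOfCodim i p) (hsm : AlgebraicGeometry.Smooth (i ≫ X.hom))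
    (hconn : ConnectedSpace Z) :
    AlgebraicGeometry.IsIntegral Z ∧ ∀ z ∈ Set.range i.base, ((p : ℕ) : ℕ∞) ≤ Order.coheight z := by
  haveI := hsm
  exact ⟨isIntegral_of_smooth_connected (i ≫ X.hom), hreg.le_coheight_of_mem_range⟩

/-- **C6 FROM C5 + SMOOTH + CONNECTED ON THE PAD-4 ANCHOR** (any codimension `p`; the checker uses `p = 4`). -/
theorem cSix_pad4Anchor {E₀ : AbelianVariety ℂ} {Z : Scheme.{0}} {i : Z ⟶ (pad4Anchor E₀).X.left} {p : ℕ}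
    (hreg : IsRegularImmersionOfCodim i p) (hsm : AlgebraicGeometry.Smooth (i ≫ (pad4Anchor E₀).X.hom))
    (hconn : ConnectedSpace Z) :
    AlgebraicGeometry.IsIntegral Z ∧ ∀ z ∈ Set.range i.base, ((p : ℕ) : ℕ∞) ≤ Order.coheight z := by
  haveI := isLocallyNoetherian_pad4Anchor E₀
  exact cSix_of_regular_smooth_connected (pad4Anchor E₀).X hreg hsm hconn

variable {E₀ : AbelianVariety ℂ} {ψ₀ : E₀ ⟶ E₀} {C : ChernCharacterBetti}

/-- **THE C6-FREE SEED CHECKER (lci ∕ Bloch door) — a predicate on (design json, presentation)**: v4's `Design.SeedCheck` with the two C6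
conjuncts (integral; codimension `≥ 4` pointwise) REPLACED by «`Z` smooth over `ℂ`» and «`Z` connected» — the shape in which a zero-locus
candidate `Z(s)` actually arrives (Bertini: smooth; Fulton–Lazarsfeld: connected). Conjuncts: C0 (`D.ClassData`), closed immersion, C5
(regular immersion of codimension `4`), smooth, connected, C7 (Bloch-semiregular in the `8`-fold), (σ) object half (`q·h_K⁴ + wOf μ(D)`
supported on `Z`). SUFFICIENT for `SeedCheck` (`SmoothSeedCheck.seedCheck`), NOT equivalent (an integral lci seed may be singular). -/
def Design.SmoothSeedCheck (D : Design) (K : AnchorKit E₀ ψ₀) {Z : Scheme.{0}} (i : Z ⟶ (pad4Anchor E₀).X.left) (q : ℚ) :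
    Prop :=
  D.ClassData ∧ IsClosedImmersion i ∧ IsRegularImmersionOfCodim i 4 ∧ AlgebraicGeometry.Smooth (i ≫ (pad4Anchor E₀).X.hom) ∧
    ConnectedSpace Z ∧ IsBlochSemiregular i (2 * 4) 4 ∧
    ((q : ℚ) : ℂ) • cupPowTwo (symH (pad4Action E₀ ψ₀) K.pol.e K.pol.a) 4 + K.F.wOf D.mu ∈
      classesSupportedOn (pad4Anchor E₀).X (Set.range i.base) (2 * 4)

/-- **C6 is not a check**: a pair passing the C6-free checker passes v4's checker (C6 supplied by `cSix_pad4Anchor`). -/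
theorem Design.SmoothSeedCheck.seedCheck {D : Design} {K : AnchorKit E₀ ψ₀} {Z : Scheme.{0}}
    {i : Z ⟶ (pad4Anchor E₀).X.left} {q : ℚ} (h : D.SmoothSeedCheck K i q) : D.SeedCheck K i q := by
  obtain ⟨hC0, hci, hreg, hsm, hconn, hsr, hq⟩ := h
  obtain ⟨hint, hcoh⟩ := cSix_pad4Anchor hreg hsm hconn
  exact ⟨hC0, hci, hreg, hint, hcoh, hsr, hq⟩

/-- … hence the conclusion of `stub_rung_pad4_seedAt` ON THAT ANCHOR (v4 `seedData_of_seedCheck`). -/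
theorem seedData_of_smoothSeedCheck (hE : E₀.dim = 1) (hψ : ψ₀ ≫ ψ₀ = -(1 • 𝟙 E₀)) {D : Design} {K : AnchorKit E₀ ψ₀}
    {Z : Scheme.{0}} {i : Z ⟶ (pad4Anchor E₀).X.left} {q : ℚ} (h : D.SmoothSeedCheck K i q) :
    ∃ (e : ProjectiveEmbedding (pad4Anchor E₀).X) (a : complexBetti (projectiveSpace e.n ℂ) 2)
      (w : complexBetti (pad4Anchor E₀).X (2 * 4)),
      IsRationalClass a ∧ a ≠ 0 ∧
      IsHyperbolicWeilType (pad4Anchor E₀) (pad4Action E₀ ψ₀) 4 (symH (pad4Action E₀ ψ₀) e a) ∧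
      w ∈ weilClassesOf (pad4Anchor E₀) (pad4Action E₀ ψ₀) 4 1 ∧ IsRationalClass w ∧ w ≠ 0 ∧
      HasBlochSeedAt 4 (pad4Anchor E₀) (symH (pad4Action E₀ ψ₀) e a) w :=
  seedData_of_seedCheck hE hψ h.seedCheck

/-- **PASSING C6-FREE PAIRS ON EVERY CM ANCHOR ⟹ THE CRUX `BlochSeedDiscOne` BY NAME** (hypothesis-carrying, not `exact?`-abusable: per
anchor a design, a kit and a smooth connected regular Bloch-semiregular seed carrying the class — data no one has constructed). -/
theorem blochSeedDiscOne_of_smoothSeedChecks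
    (h : ∀ (E₀ : AbelianVariety ℂ) (ψ₀ : E₀ ⟶ E₀), E₀.dim = 1 → ψ₀ ≫ ψ₀ = -(1 • 𝟙 E₀) →
      ∃ (D : Design) (K : AnchorKit E₀ ψ₀) (Z : Scheme.{0}) (i : Z ⟶ (pad4Anchor E₀).X.left) (q : ℚ),
        D.SmoothSeedCheck K i q) :
    Summit.HodgeConjecture.HodgeConjecture.Theses.EightfoldBlochSeeds.BlochSeedDiscOne :=
  blochSeedDiscOne_of_seedChecks fun E₀ ψ₀ hE hψ => by
    obtain ⟨D, K, Z, i, q, hc⟩ := h E₀ ψ₀ hE hψ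
    exact ⟨D, K, Z, i, q, hc.seedCheck⟩

/-- **THE LCI DOOR END-TO-END FROM A SMOOTH CONNECTED ZERO SCHEME, GIVEN THE LAW** — v4's `Design.seedCheck_of_zeroScheme` with the C6
hypotheses `hint`, `hcoh` REPLACED by «`Z` smooth over `ℂ`» and «`Z` connected»: a design `D` passing C0, a rank-`4` bundle `𝓕` on the anchor
(A1)-clean at the seed with the design's `μ` in a window `⊇ {1,2,3}`, a section `s` whose zero scheme `i : Z ↪ S⁴` is regular of codimension `4`
(C5), smooth, connected and Bloch-semiregular (C7) ⟹ `D.SeedCheck K i q` for some rational `q`. -/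
theorem Design.seedCheck_of_smoothZeroScheme (hE : E₀.dim = 1) (hψ : ψ₀ ≫ ψ₀ = -(1 • 𝟙 E₀)) {D : Design} (hC0 : D.ClassData)
    (K : AnchorKit E₀ ψ₀) {I : Finset ℕ} {𝓕 : (pad4Anchor E₀).X.left.Modules} (hloc : TopChernFourLocalisation C)
    (hrk : HasRank 𝓕 4) (hcl : CleanAtSeed C I K.F (hStd E₀ K.η) 𝓕 D.mu) (h1 : 1 ∈ I) (h2 : 2 ∈ I) (h3 : 3 ∈ I)
    (s : Modules.unitModule (pad4Anchor E₀).X.left ⟶ 𝓕) {Z : Scheme.{0}} {i : Z ⟶ (pad4Anchor E₀).X.left}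
    (hZ : IsZeroSchemeOf s i) (hreg : IsRegularImmersionOfCodim i 4) (hsm : AlgebraicGeometry.Smooth (i ≫ (pad4Anchor E₀).X.hom))
    (hconn : ConnectedSpace Z) (hsr : IsBlochSemiregular i (2 * 4) 4) :
    ∃ q : ℚ, D.SeedCheck K i q := by
  obtain ⟨hint, hcoh⟩ := cSix_pad4Anchor hreg hsm hconn
  exact D.seedCheck_of_zeroScheme hE hψ hC0 K hloc hrk hcl h1 h2 h3 s hZ hreg hint hcoh hsr

/-- **THE TWISTED KERNEL ROUTE, C6-FREE** (v4 `Design.seedCheck_of_twistedKernelPresentation` with `hint`, `hcoh` replaced by smooth + connected):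
`𝓕 ≅ ker(𝓝 ↠ 𝓟)` presents the twisted design `D(t)` through a word frame linked to the kit; `s ∈ H⁰(𝓕)` has a smooth connected regular
Bloch-semiregular zero scheme ⟹ `D.SeedCheck K i q` for some `q`. -/
theorem Design.seedCheck_of_twistedKernelPresentation_smooth (hE : E₀.dim = 1) (hψ : ψ₀ ≫ ψ₀ = -(1 • 𝟙 E₀)) {D : Design}
    (hC0 : D.ClassData) (K : AnchorKit E₀ ψ₀) {Φ : WordFrame E₀} (hΦ : Φ.LinksTo K.F (hStd E₀ K.η)) (t : ℤ)
    {𝓕 : (pad4Anchor E₀).X.left.Modules} (π : KernelPresentation C Φ (D.tw t) 𝓕) (hloc : TopChernFourLocalisation C)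
    (hrk : HasRank 𝓕 4) (s : Modules.unitModule (pad4Anchor E₀).X.left ⟶ 𝓕) {Z : Scheme.{0}}
    {i : Z ⟶ (pad4Anchor E₀).X.left} (hZ : IsZeroSchemeOf s i) (hreg : IsRegularImmersionOfCodim i 4)
    (hsm : AlgebraicGeometry.Smooth (i ≫ (pad4Anchor E₀).X.hom)) (hconn : ConnectedSpace Z)
    (hsr : IsBlochSemiregular i (2 * 4) 4) : ∃ q : ℚ, D.SeedCheck K i q := by
  obtain ⟨hint, hcoh⟩ := cSix_pad4Anchor hreg hsm hconn
  exact D.seedCheck_of_twistedKernelPresentation hE hψ hC0 K hΦ t π hloc hrk s hZ hreg hint hcoh hsr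

/-- **… and the twisted COKERNEL route, C6-free** (`𝓕 ≅ coker(𝓟 ↪ 𝓝)` presenting `D(t)`). -/
theorem Design.seedCheck_of_twistedCokernelPresentation_smooth (hE : E₀.dim = 1) (hψ : ψ₀ ≫ ψ₀ = -(1 • 𝟙 E₀)) {D : Design}
    (hC0 : D.ClassData) (K : AnchorKit E₀ ψ₀) {Φ : WordFrame E₀} (hΦ : Φ.LinksTo K.F (hStd E₀ K.η)) (t : ℤ)
    {𝓕 : (pad4Anchor E₀).X.left.Modules} (π : CokernelPresentation C Φ (D.tw t) 𝓕) (hloc : TopChernFourLocalisation C)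
    (hrk : HasRank 𝓕 4) (s : Modules.unitModule (pad4Anchor E₀).X.left ⟶ 𝓕) {Z : Scheme.{0}}
    {i : Z ⟶ (pad4Anchor E₀).X.left} (hZ : IsZeroSchemeOf s i) (hreg : IsRegularImmersionOfCodim i 4)
    (hsm : AlgebraicGeometry.Smooth (i ≫ (pad4Anchor E₀).X.hom)) (hconn : ConnectedSpace Z)
    (hsr : IsBlochSemiregular i (2 * 4) 4) : ∃ q : ℚ, D.SeedCheck K i q := by
  obtain ⟨hint, hcoh⟩ := cSix_pad4Anchor hreg hsm hconn
  exact D.seedCheck_of_twistedCokernelPresentation hE hψ hC0 K hΦ t π hloc hrk s hZ hreg hint hcoh hsr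

/-- **SMOOTH CONNECTED REGULAR BLOCH-SEMIREGULAR ZERO SCHEMES ON EVERY CM ANCHOR ⟹ THE CRUX `BlochSeedDiscOne` BY NAME, GIVEN THE LAW**
(v4 `blochSeedDiscOne_of_zeroSchemes` with the C6 conjuncts replaced by smooth + connected; hypothesis-carrying: the law AND, per anchor, a
design, a kit, a clean rank-`4` bundle, a section and its zero scheme passing C5, smooth, connected, C7 — data no one has constructed). -/
theorem blochSeedDiscOne_of_smoothZeroSchemes (hloc : TopChernFourLocalisation C)
    (h : ∀ (E₀ : AbelianVariety ℂ) (ψ₀ : E₀ ⟶ E₀), E₀.dim = 1 → ψ₀ ≫ ψ₀ = -(1 • 𝟙 E₀) →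
      ∃ (D : Design) (_ : D.ClassData) (K : AnchorKit E₀ ψ₀) (I : Finset ℕ) (_ : 1 ∈ I) (_ : 2 ∈ I) (_ : 3 ∈ I)
        (𝓕 : (pad4Anchor E₀).X.left.Modules) (_ : HasRank 𝓕 4) (_ : CleanAtSeed C I K.F (hStd E₀ K.η) 𝓕 D.mu)
        (s : Modules.unitModule (pad4Anchor E₀).X.left ⟶ 𝓕) (Z : Scheme.{0}) (i : Z ⟶ (pad4Anchor E₀).X.left),
        IsZeroSchemeOf s i ∧ IsRegularImmersionOfCodim i 4 ∧ AlgebraicGeometry.Smooth (i ≫ (pad4Anchor E₀).X.hom) ∧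
          ConnectedSpace Z ∧ IsBlochSemiregular i (2 * 4) 4) :
    Summit.HodgeConjecture.HodgeConjecture.Theses.EightfoldBlochSeeds.BlochSeedDiscOne :=
  blochSeedDiscOne_of_seedChecks fun E₀ ψ₀ hE hψ => by
    obtain ⟨D, hC0, K, I, h1, h2, h3, 𝓕, hrk, hcl, s, Z, i, hZ, hreg, hsm, hconn, hsr⟩ := h E₀ ψ₀ hE hψ
    obtain ⟨q, hq⟩ := D.seedCheck_of_smoothZeroScheme hE hψ hC0 K hloc hrk hcl h1 h2 h3 s hZ hreg hsm hconn hsr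
    exact ⟨D, K, Z, i, q, hq⟩

end CSixFree

/-! ## §18.3 O-Θ: ample Cartier divisors on the anchor, and one on the line of `h_std` from the kit -/

section AmpleOnAnchor

variable {E₀ : AbelianVariety ℂ} {ψ₀ : E₀ ⟶ E₀}

/-- **EVERY ABELIAN VARIETY CARRIES AN AMPLE CARTIER DIVISOR — so the pad-4 anchor does** (Görtz–Wedhorn II Rem. 27.185 via a projective
embedding; the tree's `AbelianVariety.exists_isAmple_symmetric_holds`, of which we keep the ample half). This is the `Θ` the laws (L-conn) ∕ (L-Bert) of
v17 quantify over; kit-free and design-free. [cite: GortzWedhorn2023, Rem. 27.185 (p. 887)] -/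
theorem exists_isAmple_pad4Anchor (E₀ : AbelianVariety ℂ) : ∃ Θ : CartierDivisor (pad4Anchor E₀).X.left, Θ.IsAmple := by
  obtain ⟨Θ, hΘ, -⟩ := (AbelianVariety.exists_isAmple_symmetric_holds (A := pad4Anchor E₀))
  exact ⟨Θ, hΘ⟩

/-- the pad-4 anchor is smooth projective of dimension `2·4` (every abelian variety is, `AbelianVariety.isSmoothProjective_holds`;
`pad4Anchor_dim`). [cite: GortzWedhorn2023, Prop. 27.174 (p. 880)] -/
theorem isSmoothProjective_pad4Anchor (hE : E₀.dim = 1) : IsSmoothProjective (2 * 4) (pad4Anchor E₀).X := by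
  have h : IsSmoothProjective (pad4Anchor E₀).dim (pad4Anchor E₀).X :=
    AbelianVariety.isSmoothProjective_holds (A := pad4Anchor E₀)
  rwa [pad4Anchor_dim hE] at h

/-- the pad-4 anchor is an integral scheme (geometrically integral over `ℂ`; Mathlib `GeometricallyIntegral.isIntegral_of_subsingleton`).
A `theorem`, not an instance (typer lint); v17 states the same as `pad4Anchor_isIntegral`. [folklore] -/
theorem isIntegral_pad4Anchor_left (E₀ : AbelianVariety ℂ) : AlgebraicGeometry.IsIntegral (pad4Anchor E₀).X.left :=
  GeometricallyIntegral.isIntegral_of_subsingleton (pad4Anchor E₀).X.hom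

/-- **AN AMPLE CARTIER DIVISOR ON THE LINE OF `h_std`, FROM THE KIT**: the hyperplane divisor `H_e` of the kit's projective embedding
`e = K.pol.e` is ample, and its divisor-class line (the tree's `IsDivisorClassLineOf`: `θ = c · ch₁^M(𝒪(H_e))` in a Hodge model `M`) contains
`e^*a` (`exists_isAmple_isDivisorClassLineOf_map_ι`), hence `h_std = t⁻¹ · e^*a` (`K.pol.pullback_eq`, `t > 0`). What it does NOT give (flag
O-Θ_std of the module docstring): the normalisation `c₁^C(𝒪(Θ)) = h_std` in the ABSTRACT theory `C` that v17's dictionary clause needs.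
[cite: GortzWedhorn2020, Prop. 13.47 (iv) (p. 493)] [cite: VoisinHodgeI2002, §7.2.1 Thm. 7.14] -/
theorem exists_isAmple_lineOf_hStd (hE : E₀.dim = 1) [AlgebraicGeometry.IsIntegral (pad4Anchor E₀).X.left]
    (K : AnchorKit E₀ ψ₀) :
    ∃ Θ : CartierDivisor (pad4Anchor E₀).X.left, Θ.IsAmple ∧
      IsDivisorClassLineOf (2 * 4) (pad4Anchor E₀).X Θ (hStd E₀ K.η) := by
  obtain ⟨Θ, hΘ, M, c, hc⟩ :=
    exists_isAmple_isDivisorClassLineOf_map_ι (isSmoothProjective_pad4Anchor hE) (by norm_num) K.pol.e K.pol.a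
  refine ⟨Θ, hΘ, M, ((K.pol.t : ℚ) : ℂ)⁻¹ * c, ?_⟩
  have ht : ((K.pol.t : ℚ) : ℂ) ≠ 0 := by exact_mod_cast K.pol.t_pos.ne'
  rw [mul_smul, ← hc, K.pol.pullback_eq, smul_smul, inv_mul_cancel₀ ht, one_smul]

/-- … and on the line of the kit's own polarisation class `h_K = symH (pad4Action E₀ ψ₀) e a = 2t·h_std` (v4 `AnchorKit.symH_eq`). -/
theorem exists_isAmple_lineOf_symH (hE : E₀.dim = 1) (hψ : ψ₀ ≫ ψ₀ = -(1 • 𝟙 E₀))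
    [AlgebraicGeometry.IsIntegral (pad4Anchor E₀).X.left] (K : AnchorKit E₀ ψ₀) :
    ∃ Θ : CartierDivisor (pad4Anchor E₀).X.left, Θ.IsAmple ∧
      IsDivisorClassLineOf (2 * 4) (pad4Anchor E₀).X Θ (symH (pad4Action E₀ ψ₀) K.pol.e K.pol.a) := by
  obtain ⟨Θ, hΘ, M, c, hc⟩ := exists_isAmple_lineOf_hStd hE K
  refine ⟨Θ, hΘ, M, (((2 * K.pol.t : ℚ)) : ℂ) * c, ?_⟩
  rw [K.symH_eq hE hψ, hc, smul_smul]

end AmpleOnAnchor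

/-! ## Audit: nothing is decided here

v18 (§18): `isIntegral_of_smooth_connected`, `smoothConnectedIntegral_holds` (the law (L-int) of v17, PROVED), `cSix_of_regular_smooth_connected`, `cSix_pad4Anchor`,
`isLocallyNoetherian_pad4Anchor`, `Design.SmoothSeedCheck` (a predicate — the C6-free checker), `Design.SmoothSeedCheck.seedCheck`,
`seedData_of_smoothSeedCheck`, `blochSeedDiscOne_of_smoothSeedChecks`, `Design.seedCheck_of_smoothZeroScheme`,
`Design.seedCheck_of_twistedKernelPresentation_smooth`, `Design.seedCheck_of_twistedCokernelPresentation_smooth`, `blochSeedDiscOne_of_smoothZeroSchemes`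
(hypothesis-carrying: the law `TopChernFourLocalisation` and ∕ or a passing pair among the hypotheses — data no one has constructed),
`exists_isAmple_pad4Anchor`, `isSmoothProjective_pad4Anchor`, `isIntegral_pad4Anchor_left`, `exists_isAmple_lineOf_hStd`, `exists_isAmple_lineOf_symH`
(proved from the tree's abelian-variety and hyperplane-class theorems). Every `theorem` is proved; no named fact, no `sorry`, no new axiom, no instance,
no notation. HC ∕ HC_CM ∕ HC_AV ∕ №4 ∕ 26512 ∕ `BlochSeedDiscOne` (18881) ∕ H2 are NOT proved here; `stub_rung_pad4_seedAt` stays open. -/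

end Summit.HodgeConjecture.HodgeConjecture.Cruxes.BlochSeedDiscOne.SeedChecker

end
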